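import Summits.QuantumFields.GaugeBoot.DiagonalRPTorusNegativeOdd
import Summits.QuantumFields.GaugeBoot.DiagonalRPTorusInnerHalfNegativeEven
import HarnessLib

/-!
# No finite-torus route to three-dimensional Class B (gauge-boot, task L3(ν), summary)

HONEST FRAMING (cell `pub-gaugeboot`, page 1 of every file): the venture produces certified bounds
on lattice expectations at stated coupling, gauge group, dimension and torus size; NOT a mass gap,
NOT a continuum limit, NOT a string tension; NOT Yang–Mills-summit-bearing (barriers
`FixedCouplingUltralocality`, `PerturbativeInvisibility`). This module records two COROLLARIES of
the structural negatives `DiagonalRPTorusNegativeOdd` / `DiagonalRPTorusInnerHalfNegativeEven`, in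
the exact hypothesis shape of the cell's Class-B transfer; it discharges nothing else.

## Content

In two dimensions, L3(ι) (`ClassBTwoDimensional`) proves `ThermodynamicLimitIsClassB 2 ρ β` by
transferring diagonal reflection positivity from the tori to every infinite-volume limit point;
the transfer `ClassBLimitDiagonalGeometry.torusLimitPointsDiagonalRP_of_innerDiagonalRP` is stated
for every `d` under the hypothesis

  `∀ i j : Fin d, i ≠ j → ∃ L₀, ∀ L, L₀ ≤ L → InnerDiagonalRP (d := d) (L := L + 1) ρ β i j`.

Here, for `d = 3` and every compact group with a sign character (`ℤ₂` lattice gauge theory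
included):

* **`DiagRPThree.not_eventually_innerDiagonalRP_three`** — that hypothesis is FALSE for every
  `0 < β ≤ 1/5000` (the even tori `L ≥ 6` violate inner-half diagonal RP for the pair `(0, 1)`);
* **`DiagRPThree.not_eventually_diagonalReflectionPositive_odd_three`** — nor is closed-half
  diagonal RP eventually available along the odd tori (`0 < β ≤ 1/10000`), the other leg of the
  two-dimensional argument.

## What is NOT claimed

Nothing about `TorusLimitPointsDiagonalRP 3 ρ β` or `ThermodynamicLimitIsClassB 3 ρ β` themselves
(OPEN in general; TRUE at small `β`, where the infinite-volume state is unique and diagonal-RP,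
`ClassBStrongCoupling`): only the finite-torus ROUTE to them is closed, at both parities, already
for `ℤ₂` — the small-`β` tori are not diagonal-RP although their unique limit is.

Sources: Osterwalder–Seiler, Ann. Phys. 110 (1978) 440, §§2–3; Kazakov–Zheng, arXiv:2203.11360 §3.1.
Printed precedent (nearest-neighbour spin systems, a remark without proof): periodic boundary conditions destroy
diagonal RP — Fröhlich–Israel–Lieb–Simon, J. Stat. Phys. 22 (1980) 297, §3 (Model 3.1); M. Biskup, in LNM 1970
(2009) §5.5; the statements here are theorem-level, gauge-theoretic forms of that obstruction (tribunal t2 F-R1).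
-/

open MeasureTheory Complex Finset
open scoped ComplexOrder

namespace Summit.QuantumFields.GaugeBoot

open Literature.MathematicalPhysics.QuantumFieldTheory

namespace DiagRPThree

section NoTransfer

variable {G : Type*} [Group G] [TopologicalSpace G] [IsTopologicalGroup G] [CompactSpace G]
  [MeasurableSpace G] [BorelSpace G] {ρ : G →* Matrix (Fin 1) (Fin 1) ℂ}

/-- **The Class-B transfer cannot be fed in three dimensions.** For a compact group with a sign
character and `0 < β ≤ 1/5000`, the hypothesis of
`ClassBLimitDiagonalGeometry.torusLimitPointsDiagonalRP_of_innerDiagonalRP` — inner-half diagonal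
RP of all large tori for every pair of directions — fails for `d = 3`: the pair `(0, 1)` and the
even tori `(ℤ/2m)³`, `2m ≥ 6`, violate it (`not_innerDiagonalRP_even`). -/
theorem not_eventually_innerDiagonalRP_three (hρ : Continuous ρ) (hval : ∀ g, ρ g = 1 ∨ ρ g = -1)
    (hne : ∃ g, ρ g = -1) {β : ℝ} (hβ : 0 < β) (hβ1 : β ≤ 1 / 5000) :
    ¬ (∀ i j : Fin 3, i ≠ j →
      ∃ L₀ : ℕ, ∀ L : ℕ, L₀ ≤ L → InnerDiagonalRP (d := 3) (L := L + 1) ρ β i j) := by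
  intro H
  obtain ⟨L₀, hL₀⟩ := H 0 1 (by decide)
  exact not_innerDiagonalRP_even (L := 2 * L₀ + 5 + 1) ⟨L₀ + 3, by ring⟩ (by omega) hρ hval hne
    hβ hβ1 (hL₀ (2 * L₀ + 5) (by omega))

/-- **Nor along the odd tori with the closed half.** For a compact group with a sign character and
`0 < β ≤ 1/10000`, closed-half diagonal RP for the pair `(0, 1)` is not eventually available along
the odd three-tori (`not_diagonalReflectionPositive_odd`), so the odd-torus leg of the
two-dimensional Class-B argument (`DiagonalRPTorusOdd` + `ClassBTwoDimensional`) has no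
three-dimensional analogue either. -/
theorem not_eventually_diagonalReflectionPositive_odd_three (hρ : Continuous ρ)
    (hval : ∀ g, ρ g = 1 ∨ ρ g = -1) (hne : ∃ g, ρ g = -1) {β : ℝ} (hβ : 0 < β)
    (hβ1 : β ≤ 1 / 10000) :
    ¬ (∃ L₀ : ℕ, ∀ L : ℕ, L₀ ≤ L → Odd (L + 1) →
      DiagonalReflectionPositive (d := 3) (L := L + 1) ρ β 0 1) := by
  rintro ⟨L₀, hL₀⟩
  have hodd : Odd (2 * (L₀ + 1) + 1) := ⟨L₀ + 1, rfl⟩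
  exact not_diagonalReflectionPositive_odd (L := 2 * (L₀ + 1) + 1) hodd (by omega) hρ hval hne hβ
    hβ1 (hL₀ (2 * (L₀ + 1)) (by omega) hodd)

/-- The `ℤ₂` instance of `not_eventually_innerDiagonalRP_three`: for `ℤ₂` lattice gauge theory on
three-tori at `0 < β ≤ 1/5000` the transfer hypothesis fails. -/
theorem not_eventually_innerDiagonalRP_three_intUnits {β : ℝ} (hβ : 0 < β) (hβ1 : β ≤ 1 / 5000) :
    ¬ (∀ i j : Fin 3, i ≠ j →
      ∃ L₀ : ℕ, ∀ L : ℕ, L₀ ≤ L → InnerDiagonalRP (d := 3) (L := L + 1) signRepIntUnits β i j) :=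
  not_eventually_innerDiagonalRP_three continuous_of_discreteTopology signRepIntUnits_eq_one_or
    ⟨-1, signRepIntUnits_neg_one⟩ hβ hβ1

end NoTransfer

end DiagRPThree

end Summit.QuantumFields.GaugeBoot
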